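/- Width seat 2/3 `ym-line-cbag-p1-w2` (prover-ym-line-cbag-p1-w2-g20-0) of the cell of ideator ym-idea-2, LINE 8
(route `EguchiKawaiDirectionLadder`), post-closure glue for the barrier entry `EguchiKawaiBreakdown`: the WILSON WORDS
`(1/N) tr ∏ⱼ U_{μⱼ}^{±1}` of the Eguchi–Kawai single-site model (Makeenko (14.44)–(14.48)) — the objects.  Route-independent;
YM mass gap NOT touched (barrier-ledger line). -/
import Literature.Barriers.QuantumFields.EguchiKawaiBreakdownSpecialUnitaryCentre
import Summits.Ventures.YMGap.Thresholds.LatticeBakryEmeryIntegration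
import HarnessLib

/-!
# Wilson words of the Eguchi–Kawai single-site model: definitions and algebra

The barrier entry `Literature.Barriers.QuantumFields.EguchiKawaiBreakdown` transcribes the standing hypothesis of the
Eguchi–Kawai reduction through the ELEMENTARY open lines `openLine μ U = (1/N) tr U_μ` only.  Makeenko's (14.44)–(14.51)
concern arbitrary reduced contours: a lattice contour `C = (μ₁^{ε₁}, …, μ_k^{ε_k})` (directions with orientations) is mapped to
the WORD `(1/N) tr U_{μ₁}^{ε₁} ⋯ U_{μ_k}^{ε_k}` of the single-site model ((14.44)–(14.45)); under the centre transformation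
`U_μ ↦ Z_μ U_μ` (14.41) the word picks up `∏ⱼ Z_{μⱼ}^{εⱼ}` (14.48), so it is invariant iff the contour is CLOSED (zero net
winding `q_μ(C) = #{j : μⱼ = μ, εⱼ = +} − #{j : μⱼ = μ, εⱼ = −}` in every direction), and the reduction needs the averages of
all OPEN words to vanish, `W_EK(C_xy) = δ_xy W_EK(C_xx)` (14.51).

This file sets up the words (no analysis):

* `ekWordMatrix l U`, `ekWord l U = (1/N) tr (ekWordMatrix l U)` for a letter list `l : List (Fin d × Bool)` (`(μ, true)` =
  the link `U_μ`, `(μ, false)` = `U_μ†`) and a `U(N)` configuration; `ekWord [(μ, true)] = openLine μ` (`ekWord_single`);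
* the ambient versions `ekWordMat l : (Fin d → M_N(ℂ)) → M_N(ℂ)`, `ekWordRe l / ekWordIm l` (real and imaginary parts of
  the word, divided by `N`) for the multi-link Bakry–Émery engine of venture YMGap (`Cfg`, `emb`), with `ekWordRe_emb`;
* the letter counts `wordMult l μ` (multiplicity of the direction `μ`), `wordPlus / wordMinus l μ` and the winding
  `wordCharge l μ : ℤ`;
* PROVED algebra: words of unitary configurations are unitary (`ekWordMatrix_mem_unitaryGroup`); the **phase covariance**
  (14.48) `ekWordMatrix l U' = (∏ⱼ phase) • ekWordMatrix l U` when `U'_μ = c_μ U_μ` (`ekWordMatrix_phase`), hence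
  `‖ekWord l ·‖²` is phase invariant (`isPhaseInvariant_normSq_ekWord`); under the `ℤ_N` rotation of ONE link the word
  picks up `ω^{n₊} ω̄^{n₋}` (`ekWord_centerRotateSU`); continuity.

The analysis (per-link Lipschitz bounds, large-`N` concentration of every word and vanishing of every open word at strong
coupling) is in `EguchiKawaiDirectionLadderWilsonWords.lean`.

References: Y. Makeenko, *Methods of Contemporary Gauge Theory* (CUP 2023) §14.3 (14.41), (14.44)–(14.48), Problem 14.2
(14.50)–(14.51) (PDF pp. 245–247).  HONEST FRAMING: objects of a barrier-ledger theorem about the single-site model; no statement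
about the Yang–Mills mass gap / the summit `YangMills` is made or advanced here.
-/

set_option autoImplicit false

noncomputable section

open scoped Matrix ComplexConjugate BigOperators
open Matrix Complex MeasureTheory Filter Topology
open Summit.Ventures.YMGap.LatticeBakryEmery (Cfg PSU emb emb_apply)
open Literature.Barriers.QuantumFields (UN EKConfig EKConfigSU inclSU openLine coe_inclSU_apply IsPhaseInvariant
  centerRoot centerRotateSU coe_inclSU_centerRotateSU continuous_coeLink)

namespace Summit.QuantumFields.YangMills.Theorems.EguchiKawaiDirectionLadder

variable {d N : ℕ}

/-! ## Words of `U(N)` configurations -/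

/-- The matrix of one letter `(μ, ε)`: the link `U_μ` for `ε = true`, its adjoint `U_μ† = U_μ⁻¹` for `ε = false`
(Makeenko (14.44): `U_{x,μ} → U_μ`, reversed links to the inverse). -/
def ekLetterMatrix (U : EKConfig d N) (a : Fin d × Bool) : Matrix (Fin N) (Fin N) ℂ :=
  if a.2 then ((U a.1 : UN N) : Matrix (Fin N) (Fin N) ℂ) else ((U a.1 : UN N) : Matrix (Fin N) (Fin N) ℂ)ᴴ

/-- The **word matrix** `U_{μ₁}^{ε₁} ⋯ U_{μ_k}^{ε_k}` of a letter list (the reduced parallel transporter of a lattice contour,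
Makeenko (14.44)–(14.45)). -/
def ekWordMatrix (l : List (Fin d × Bool)) (U : EKConfig d N) : Matrix (Fin N) (Fin N) ℂ :=
  (l.map (ekLetterMatrix U)).prod

/-- The **Wilson word** `(1/N) tr U_{μ₁}^{ε₁} ⋯ U_{μ_k}^{ε_k}` of the single-site model (the right-hand side of the reduction
formula (14.45); for a one-letter list it is the elementary open line `openLine μ`). -/
def ekWord (l : List (Fin d × Bool)) (U : EKConfig d N) : ℂ :=
  (ekWordMatrix l U).trace / N

/-- The empty word is the identity matrix. -/
@[simp] theorem ekWordMatrix_nil (U : EKConfig d N) : ekWordMatrix [] U = 1 := by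
  simp [ekWordMatrix]

/-- Prepending a letter multiplies on the left. -/
@[simp] theorem ekWordMatrix_cons (a : Fin d × Bool) (l : List (Fin d × Bool)) (U : EKConfig d N) :
    ekWordMatrix (a :: l) U = ekLetterMatrix U a * ekWordMatrix l U := by
  simp [ekWordMatrix]

/-- The one-letter word `(μ, +)` is the elementary open line `(1/N) tr U_μ` of the barrier file. -/
theorem ekWord_single (μ : Fin d) (U : EKConfig d N) : ekWord [(μ, true)] U = openLine μ U := by
  simp [ekWord, ekWordMatrix, ekLetterMatrix, openLine]

/-- A letter of a unitary configuration is unitary. -/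
theorem ekLetterMatrix_mem_unitaryGroup (U : EKConfig d N) (a : Fin d × Bool) :
    ekLetterMatrix U a ∈ Matrix.unitaryGroup (Fin N) ℂ := by
  unfold ekLetterMatrix
  split_ifs
  · exact (U a.1).2
  · rw [← star_eq_conjTranspose]; exact Unitary.star_mem (U a.1).2

/-- **Words of unitary configurations are unitary.** -/
theorem ekWordMatrix_mem_unitaryGroup (l : List (Fin d × Bool)) (U : EKConfig d N) :
    ekWordMatrix l U ∈ Matrix.unitaryGroup (Fin N) ℂ := by
  induction l with
  | nil => rw [ekWordMatrix_nil]; exact Submonoid.one_mem _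
  | cons a l ih => rw [ekWordMatrix_cons]; exact Submonoid.mul_mem _ (ekLetterMatrix_mem_unitaryGroup U a) ih

/-! ## Letter counts and the winding number of a word -/

/-- The multiplicity of the direction `μ` in the word (letters `U_μ` and `U_μ†` together). -/
def wordMult (l : List (Fin d × Bool)) (μ : Fin d) : ℕ := l.countP fun a => a.1 = μ

/-- The number of letters `U_μ` in the word. -/
def wordPlus (l : List (Fin d × Bool)) (μ : Fin d) : ℕ := l.countP fun a => a = (μ, true)

/-- The number of letters `U_μ†` in the word. -/
def wordMinus (l : List (Fin d × Bool)) (μ : Fin d) : ℕ := l.countP fun a => a = (μ, false)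

/-- The **winding number** (centre charge) of the word in direction `μ`: `#U_μ − #U_μ†`.  The word is invariant under the
centre transformation `U_μ ↦ Z_μ U_μ` (14.41) iff this vanishes (14.48); a lattice contour is closed iff all its windings
vanish. -/
def wordCharge (l : List (Fin d × Bool)) (μ : Fin d) : ℤ := (wordPlus l μ : ℤ) - (wordMinus l μ : ℤ)

/-- `#U_μ + #U_μ† = ` multiplicity of `μ`. -/
theorem wordPlus_add_wordMinus (l : List (Fin d × Bool)) (μ : Fin d) :
    wordPlus l μ + wordMinus l μ = wordMult l μ := by
  induction l with
  | nil => simp [wordPlus, wordMinus, wordMult]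
  | cons a l ih =>
      obtain ⟨ν, ε⟩ := a
      simp only [wordPlus, wordMinus, wordMult, List.countP_cons] at ih ⊢
      by_cases h : ν = μ
      · subst h
        cases ε <;> simp <;> omega
      · have h1 : ¬ ((ν, ε) = (μ, true)) := fun e => h (Prod.mk.inj e).1
        have h2 : ¬ ((ν, ε) = (μ, false)) := fun e => h (Prod.mk.inj e).1
        simp [h, h1, h2]
        omega

/-- The multiplicity is at most the length of the word. -/
theorem wordMult_le_length (l : List (Fin d × Bool)) (μ : Fin d) : wordMult l μ ≤ l.length :=
  List.countP_le_length

/-- `|winding| ≤ multiplicity`. -/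
theorem abs_wordCharge_le (l : List (Fin d × Bool)) (μ : Fin d) : |wordCharge l μ| ≤ (wordMult l μ : ℤ) := by
  rw [wordCharge, ← wordPlus_add_wordMinus, abs_le]
  push_cast
  constructor <;> linarith [Nat.cast_nonneg (α := ℤ) (wordPlus l μ), Nat.cast_nonneg (α := ℤ) (wordMinus l μ)]

/-- A word of length `< N` with non-zero winding in direction `μ` has winding NOT divisible by `N` (so the `ℤ_N` rotation of
the link `μ` sees it). -/
theorem not_dvd_wordCharge {l : List (Fin d × Bool)} {μ : Fin d} (hq : wordCharge l μ ≠ 0) (hl : l.length < N) :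
    ¬ ((N : ℤ) ∣ wordCharge l μ) := by
  intro h
  have h1 : (N : ℤ) ≤ |wordCharge l μ| := Int.le_of_dvd (abs_pos.2 hq) ((dvd_abs _ _).2 h)
  have h2 := abs_wordCharge_le l μ
  have h3 := wordMult_le_length l μ
  omega

/-! ## Phase covariance (Makeenko (14.48)) -/

/-- The phase picked up by one letter under `U_ν ↦ c_ν U_ν`: `c_μ` for `U_μ`, `c̄_μ` for `U_μ†`. -/
theorem ekLetterMatrix_phase {U U' : EKConfig d N} {c : Fin d → ℂ}
    (h : ∀ ν, ((U' ν : UN N) : Matrix (Fin N) (Fin N) ℂ) = c ν • ((U ν : UN N) : Matrix (Fin N) (Fin N) ℂ))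
    (a : Fin d × Bool) :
    ekLetterMatrix U' a = (if a.2 then c a.1 else conj (c a.1)) • ekLetterMatrix U a := by
  unfold ekLetterMatrix
  split_ifs with h2
  · exact h a.1
  · rw [h a.1, conjTranspose_smul, star_def]

/-- **Phase covariance of words** ((14.48) with arbitrary phases): if `U'_ν = c_ν U_ν` for all `ν`, then
`ekWordMatrix l U' = (∏ⱼ φⱼ) • ekWordMatrix l U` with `φⱼ = c_{μⱼ}` for a letter `U_{μⱼ}` and `c̄_{μⱼ}` for `U_{μⱼ}†`. -/
theorem ekWordMatrix_phase {U U' : EKConfig d N} {c : Fin d → ℂ}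
    (h : ∀ ν, ((U' ν : UN N) : Matrix (Fin N) (Fin N) ℂ) = c ν • ((U ν : UN N) : Matrix (Fin N) (Fin N) ℂ))
    (l : List (Fin d × Bool)) :
    ekWordMatrix l U' = (l.map fun a => if a.2 then c a.1 else conj (c a.1)).prod • ekWordMatrix l U := by
  induction l with
  | nil => simp
  | cons a l ih =>
      rw [ekWordMatrix_cons, ekWordMatrix_cons, ih, ekLetterMatrix_phase h a, List.map_cons, List.prod_cons,
        smul_mul_smul_comm, mul_smul]

/-- The phase product has modulus one when all `|c_ν| = 1`. -/
theorem norm_phaseProd_eq_one {c : Fin d → ℂ} (hc : ∀ ν, ‖c ν‖ = 1) (l : List (Fin d × Bool)) :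
    ‖(l.map fun a => if a.2 then c a.1 else conj (c a.1)).prod‖ = 1 := by
  induction l with
  | nil => simp
  | cons a l ih =>
      rw [List.map_cons, List.prod_cons, norm_mul, ih, mul_one]
      split_ifs
      · exact hc a.1
      · rw [Complex.norm_conj]; exact hc a.1

/-- **`|ekWord l|²` is phase invariant** — so the `U(N)` and `SU(N)` single-site models give it the same expectation
(`ekExpectation_eq_ekExpectationSU`). -/
theorem isPhaseInvariant_normSq_ekWord (l : List (Fin d × Bool)) :
    IsPhaseInvariant fun U : EKConfig d N => ‖ekWord l U‖ ^ 2 := by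
  intro U U' h
  choose c hc hU using h
  simp only [ekWord, ekWordMatrix_phase hU l, trace_smul, smul_eq_mul, mul_div_assoc, norm_mul,
    norm_phaseProd_eq_one hc l, one_mul]

/-- The phase product of the `ℤ_N` rotation of the single link `μ` (`c_μ = ω_N`, `c_ν = 1` otherwise) is
`ω_N^{#U_μ} ω̄_N^{#U_μ†}`. -/
theorem phaseProd_centerRotate (μ : Fin d) (l : List (Fin d × Bool)) :
    (l.map fun a : Fin d × Bool =>
        if a.2 then (if a.1 = μ then centerRoot N else 1) else conj (if a.1 = μ then centerRoot N else 1)).prod =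
      centerRoot N ^ wordPlus l μ * conj (centerRoot N) ^ wordMinus l μ := by
  induction l with
  | nil => simp [wordPlus, wordMinus]
  | cons a l ih =>
      obtain ⟨ν, ε⟩ := a
      rw [List.map_cons, List.prod_cons, ih]
      simp only [wordPlus, wordMinus, List.countP_cons]
      by_cases h : ν = μ
      · subst h
        cases ε <;> simp [pow_succ] <;> ring
      · have h1 : ¬ ((ν, ε) = (μ, true)) := fun e => h (Prod.mk.inj e).1
        have h2 : ¬ ((ν, ε) = (μ, false)) := fun e => h (Prod.mk.inj e).1
        cases ε <;> simp [h, h1, h2]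

/-- **The word picks up `ω_N^{#U_μ} ω̄_N^{#U_μ†}` under the `ℤ_N` rotation `V_μ ↦ ω_N V_μ` of the `SU(N)` model**
(Makeenko (14.48) for the centre `ℤ_N ⊂ SU(N)`). -/
theorem ekWord_centerRotateSU (μ : Fin d) (l : List (Fin d × Bool)) (V : EKConfigSU d N) :
    ekWord l (inclSU (centerRotateSU μ V)) =
      centerRoot N ^ wordPlus l μ * conj (centerRoot N) ^ wordMinus l μ * ekWord l (inclSU V) := by
  have h := ekWordMatrix_phase (U := inclSU V) (U' := inclSU (centerRotateSU μ V))
    (c := fun ν => if ν = μ then centerRoot N else 1) (fun ν => coe_inclSU_centerRotateSU μ ν V) l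
  rw [ekWord, ekWord, h, phaseProd_centerRotate, trace_smul, smul_eq_mul, mul_div_assoc]

/-! ## The ambient word functions (for the multi-link Bakry–Émery engine) -/

/-- One letter on the ambient algebra `(Fin d → M_N(ℂ))`: `Q_μ` or `Q_μᴴ`. -/
def ekLetterMat (Q : Cfg (Fin d) N) (a : Fin d × Bool) : Matrix (Fin N) (Fin N) ℂ :=
  if a.2 then Q a.1 else (Q a.1)ᴴ

/-- The word matrix on the ambient algebra. -/
def ekWordMat (l : List (Fin d × Bool)) (Q : Cfg (Fin d) N) : Matrix (Fin N) (Fin N) ℂ :=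
  (l.map (ekLetterMat Q)).prod

/-- `Re ((1/N) tr word)` on the ambient algebra. -/
def ekWordRe (l : List (Fin d × Bool)) : Cfg (Fin d) N → ℝ := fun Q => (ekWordMat l Q).trace.re / N

/-- `Im ((1/N) tr word)` on the ambient algebra. -/
def ekWordIm (l : List (Fin d × Bool)) : Cfg (Fin d) N → ℝ := fun Q => (ekWordMat l Q).trace.im / N

/-- The empty ambient word is the identity. -/
@[simp] theorem ekWordMat_nil (Q : Cfg (Fin d) N) : ekWordMat [] Q = 1 := by simp [ekWordMat]

/-- Prepending a letter multiplies on the left. -/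
@[simp] theorem ekWordMat_cons (a : Fin d × Bool) (l : List (Fin d × Bool)) (Q : Cfg (Fin d) N) :
    ekWordMat (a :: l) Q = ekLetterMat Q a * ekWordMat l Q := by simp [ekWordMat]

/-- On `SU(N)^d` the ambient letter is the letter of the included configuration. -/
theorem ekLetterMat_emb (g : PSU (Fin d) N) (a : Fin d × Bool) :
    ekLetterMat (emb g) a = ekLetterMatrix (inclSU g) a := rfl

/-- On `SU(N)^d` the ambient word matrix is the word matrix of the included configuration. -/
theorem ekWordMat_emb (l : List (Fin d × Bool)) (g : PSU (Fin d) N) :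
    ekWordMat l (emb g) = ekWordMatrix l (inclSU g) := by
  induction l with
  | nil => simp
  | cons a l ih => rw [ekWordMat_cons, ekWordMatrix_cons, ih, ekLetterMat_emb]

/-- On `SU(N)^d`, `ekWordRe l` is the real part of the word. -/
theorem ekWordRe_emb (l : List (Fin d × Bool)) (g : PSU (Fin d) N) :
    ekWordRe l (emb g) = (ekWord l (inclSU g)).re := by
  simp [ekWordRe, ekWord, ekWordMat_emb, Complex.div_natCast_re]

/-- On `SU(N)^d`, `ekWordIm l` is the imaginary part of the word. -/
theorem ekWordIm_emb (l : List (Fin d × Bool)) (g : PSU (Fin d) N) :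
    ekWordIm l (emb g) = (ekWord l (inclSU g)).im := by
  simp [ekWordIm, ekWord, ekWordMat_emb, Complex.div_natCast_im]

/-! ## Continuity -/

/-- The word matrix depends continuously on the `U(N)` configuration. -/
theorem continuous_ekWordMatrix (l : List (Fin d × Bool)) :
    Continuous fun U : EKConfig d N => ekWordMatrix l U := by
  induction l with
  | nil => simp only [ekWordMatrix_nil]; exact continuous_const
  | cons a l ih =>
      simp only [ekWordMatrix_cons]
      refine Continuous.mul ?_ ih
      unfold ekLetterMatrix
      split_ifs
      · exact continuous_coeLink a.1
      · exact (continuous_coeLink a.1).matrix_conjTranspose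

/-- The word depends continuously on the `U(N)` configuration. -/
theorem continuous_ekWord (l : List (Fin d × Bool)) : Continuous fun U : EKConfig d N => ekWord l U :=
  ((continuous_ekWordMatrix l).matrix_trace).div_const _

/-- `U ↦ ‖ekWord l U‖²` is measurable. -/
theorem measurable_normSq_ekWord (l : List (Fin d × Bool)) :
    Measurable fun U : EKConfig d N => ‖ekWord l U‖ ^ 2 :=
  ((continuous_ekWord l).norm.pow 2).measurable

end Summit.QuantumFields.YangMills.Theorems.EguchiKawaiDirectionLadder
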